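import Literature.NumberTheory.Automorphic.ArchEndoscopicChartLocal           -- ★ p850034 FILE D1 (LH3-p03 (g3)): `endoBlockAt`, `chartTorusHLoc`, `chartBoxImgLoc`, `forall_mem_chartTorusHLoc_comm`, local compactness
import Literature.NumberTheory.Automorphic.ArchEndoscopicChartOrbFree         -- ★ (LH2-p04 (g3)): `quotientMeasure_eq_inv_smul_of_eq_smul` (quotient measures scale inversely with the fibre Haar measure)
import Literature.MeasureTheory.Group.InvariantQuotientExistence                 -- ★ `quotientMeasure M t ν` (Deitmar–Echterhoff Thm. 1.5.3)
import Mathlib.Topology.Baire.Lemmas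
import Mathlib.Topology.Baire.LocallyCompactRegular
import Mathlib.MeasureTheory.Measure.Haar.Unique
import HarnessLib

/-!
# The local chart orbital functional `chartOrbHLoc` of `U(Φ₂)_w` modulo the local chart torus `T_{S,w}` — the place-`w` twin of (T-MEAS) §3–§4
# ((PROD-QUOT-H) FILE D2 of the LH3 direct road: Rogawski 1990 §8.2–8.3; Shelstad 1979 §4; Deitmar–Echterhoff 2014 Thm. 1.5.3; Folland 1995 §2.2, §2.6)

Topic `NumberTheory/Automorphic`; namespace `Literature.NumberTheory.Automorphic.UnitaryGroup`.  DEFINITIONS WITH BODIES (`chartHaarHLoc`, `chartQuotientMeasureHLoc`,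
`chartOrbHLoc`) + theorems; no instance, no notation, no axiom, no named fact, no `sorry`.  Cell `pub/hodgecm-mathlib`, crux H413 (`stmt-HodgeConjecture-24833`), F0∕P3c
line LH3 (closer stub `stub_N9`, DIRECT ROAD), organ «(PROD-QUOT-H)» (LH3-plan (g2) deal 2026-09-02T06:53:06Z to LH3-p03 (g3)), part 2 of the local vocabulary over FILE D1
★ `ArchEndoscopicChartLocal`; consumed by the factorisation theorems `ArchEndoscopicChartOrbPlaces` (`chartOrbH = Π_w chartOrbHLoc` on product test functions and product
Haar measures; the partial function at one place) and the NAMED local target the rank-one letters ((K0±)-U11 ★ `ArchRankOneJumpZero`, (A0)-U11) dock to, up to the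
Cayley frame of `U(Φ₂)_w`; count-neutral.

* **`chartHaarHLoc S w`** := an AUXILIARY Haar measure `dt_w` on `T_{S,w}` (Mathlib `haarMeasure` at a fixed positive compact): Haar, regular, left ∕ inversion invariant
  (abelian), finite on compacts, open-positive, σ-finite, `dt_w(B_{S,w}) < ⊤` — the binders of ★ `quotientMeasure`.
* **`chartQuotientMeasureHLoc S w ν_w`** := ★ `quotientMeasure T_{S,w} dt_w _ ν_w` on `U(Φ₂)_w ⧸ T_{S,w}` (Borel σ-algebra fixed INSIDE, as (T-MEAS) D3).
* **`chartOrbHLoc L S w ν_w f cw := dt_w(B_{S,w}) · ∫_{U(Φ₂)_w ⧸ T_{S,w}} f (x · endoBlockAt S w cw · x⁻¹) d(dν_w ∕ dt_w)(x̄)`** (★ `descConj`), at EVERY `cw`; Haar-free by the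
  box-mass prefactor exactly as (δ3); `chartOrbHLoc_def` (rfl), `chartOrbHLoc_congr` (depends on `cw` only through the local chart point), `chartOrbHLoc_congr_slots`,
  `chartOrbHLoc_zero`; **`chartOrbHLoc_eq_of_isHaarMeasure`** — HAAR-FREENESS: for ANY inversion-invariant Haar `t` on `T_{S,w}`,
  `chartOrbHLoc = t(B_{S,w}) · ∫ … d(ν_w ∕ t)` (★ `quotientMeasure_eq_inv_smul_of_eq_smul`); `nonempty_interior_chartBoxImgLoc`, `measure_chartBoxImgLoc_pos` (Baire: the
  `2π`-translates of the box image cover `T_{S,w}`), so the prefactor never vanishes.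
HONEST LABEL: HC_CM is proved only modulo the 7 printed citations (2 remaining: hLiu418 = `stmt-HodgeConjecture-24832`, h413 = `stmt-HodgeConjecture-24833`) until rung 0
closes; measure bookkeeping, moves no row of the books.

## References
* [Rogawski1990] J. D. Rogawski, *Automorphic Representations of Unitary Groups in Three Variables*, Ann. of Math. Stud. 123 (1990), §8.2 p. 122, §8.3 p. 124.
* [Shelstad1979] D. Shelstad, *Characters and inner forms of a quasi-split group over ℝ*, Compositio Math. 39 (1979), §4 p. 22 (`T`, `dt`, `Φ^T_f`).
* [DeitmarEchterhoff2014] A. Deitmar, S. Echterhoff, *Principles of Harmonic Analysis*, 2nd ed. (2014), Thm. 1.5.3 (quotient integral formula).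
* [Folland1995] G. B. Folland, *A Course in Abstract Harmonic Analysis* (1995), §2.2 (Haar measure), §2.6 Thm. 2.49, (2.52).
-/

set_option autoImplicit false

noncomputable section

open MeasureTheory MeasureTheory.Measure NumberField NumberField.InfinitePlace Matrix Complex Topology
open Literature.MeasureTheory.Group
open scoped MatrixGroups Matrix Classical ENNReal NNReal Pointwise

namespace Literature.NumberTheory.Automorphic.UnitaryGroup


/-! ## The local Haar measure, the local quotient measure and the local chart orbital functional `chartOrbHLoc` -/

/-! ## The local box image is a fundamental box: positivity of the prefactor -/

section Box

variable (L : Type) [Field L] [NumberField L] [IsCMField L] (S : Finset {w : InfinitePlace L // IsComplex w}) (w : {w : InfinitePlace L // IsComplex w})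

omit [NumberField L] [IsCMField L] in
/-- **The local box is a fundamental box for the period lattice** (`ℤ` in the `x`-slot, `2πℤ` in the angle slots): subtract `⌊cw ∕ period⌋ · period`.
[cite: Folland1995, §2.2] -/
theorem exists_sub_mem_chartBoxLoc (cw : Fin 3 → ℝ) :
    ∃ n : Fin 3 → ℤ, (cw - fun i => (n i : ℝ) * (if w ∈ S ∧ i = 0 then 1 else 2 * Real.pi)) ∈ chartBoxLoc L S w := by
  refine ⟨fun i => ⌊cw i / (if w ∈ S ∧ i = 0 then 1 else 2 * Real.pi)⌋, fun i _ => ?_⟩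
  set p : ℝ := if w ∈ S ∧ i = 0 then 1 else 2 * Real.pi with hp
  have hp0 : 0 < p := by rw [hp]; split_ifs; exacts [one_pos, by positivity]
  have hfr : cw i - (⌊cw i / p⌋ : ℝ) * p = p * Int.fract (cw i / p) := by
    rw [Int.fract, mul_sub, mul_div_cancel₀ _ hp0.ne']
    ring
  simp only [Pi.sub_apply, Set.mem_Icc]
  rw [hfr]
  exact ⟨mul_nonneg hp0.le (Int.fract_nonneg _), by nlinarith [Int.fract_lt_one (cw i / p)]⟩

/-- **The lattice translates of the local box image cover `T_{S,w}`** (★ `mem_chartTorusHLoc_iff`). [cite: Folland1995, §2.2] -/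
theorem iUnion_smul_chartBoxImgLoc_eq_univ :
    (⋃ n : Fin 3 → ℤ,
      (⟨endoBlockAt L S w (fun i => (n i : ℝ) * (if w ∈ S ∧ i = 0 then 1 else 2 * Real.pi)), endoBlockAt_mem_chartTorusHLoc L S w _⟩ : ↥(chartTorusHLoc L S w)) •
        chartBoxImgLoc L S w) = Set.univ := by
  refine Set.eq_univ_of_forall fun t => ?_
  obtain ⟨cw, hcw⟩ := (mem_chartTorusHLoc_iff L S w t.1).mp t.2
  obtain ⟨n, hn⟩ := exists_sub_mem_chartBoxLoc L S w cw
  refine Set.mem_iUnion.mpr ⟨n, ?_⟩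
  rw [Set.mem_smul_set_iff_inv_smul_mem]
  refine ⟨cw - fun i => (n i : ℝ) * (if w ∈ S ∧ i = 0 then 1 else 2 * Real.pi), hn, ?_⟩
  apply Subtype.ext
  simp only [smul_eq_mul, Subgroup.coe_mul, Subgroup.coe_inv]
  rw [sub_eq_neg_add, endoBlockAt_add, endoBlockAt_neg, hcw]

/-- **THE LOCAL BOX IMAGE HAS NONEMPTY INTERIOR IN `T_{S,w}`** (Baire: countably many closed translates cover the locally compact Hausdorff `T_{S,w}`).
[cite: Folland1995, §2.2] -/
theorem nonempty_interior_chartBoxImgLoc : (interior (chartBoxImgLoc L S w)).Nonempty := by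
  haveI := locallyCompactSpace_chartTorusHLoc L S w
  obtain ⟨n, hn⟩ := nonempty_interior_of_iUnion_of_closed (fun n => ((isCompact_chartBoxImgLoc L S w).smul _).isClosed) (iUnion_smul_chartBoxImgLoc_eq_univ L S w)
  rw [interior_smul] at hn
  exact Set.smul_set_nonempty.mp hn

variable [MeasurableSpace ↥(archLocal L 2 (Matrix.of fun i j : Fin 2 => if i.val + j.val + 1 = 2 then (1 : L) else 0) w)]

/-- **Every measure positive on open sets gives the local box image positive mass** — in particular every Haar measure on `T_{S,w}`. [cite: Folland1995, §2.2] -/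
theorem measure_chartBoxImgLoc_pos (t : Measure ↥(chartTorusHLoc L S w)) [t.IsOpenPosMeasure] : 0 < t (chartBoxImgLoc L S w) :=
  t.measure_pos_of_nonempty_interior (nonempty_interior_chartBoxImgLoc L S w)

end Box

section LocalOrb

variable (L : Type) [Field L] (S : Finset {w : InfinitePlace L // IsComplex w}) (w : {w : InfinitePlace L // IsComplex w})
  [MeasurableSpace ↥(archLocal L 2 (Matrix.of fun i j : Fin 2 => if i.val + j.val + 1 = 2 then (1 : L) else 0) w)]
  [BorelSpace ↥(archLocal L 2 (Matrix.of fun i j : Fin 2 => if i.val + j.val + 1 = 2 then (1 : L) else 0) w)]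

/-- **THE (AUXILIARY) HAAR MEASURE `dt_w` OF THE LOCAL CHART TORUS `T_{S,w}`** (Mathlib's Haar measure at a fixed positive compact).  AUXILIARY: consumers read `chartOrbHLoc`,
which carries the prefactor `dt_w(B_{S,w})` and is therefore independent of this choice. [cite: Folland1995, §2.2; §2.6 (2.52)] [cite: Shelstad1979, §4 p. 22] -/
def chartHaarHLoc : Measure ↥(chartTorusHLoc L S w) :=
  haveI := locallyCompactSpace_chartTorusHLoc L S w
  haarMeasure (Classical.arbitrary (TopologicalSpace.PositiveCompacts ↥(chartTorusHLoc L S w)))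

/-- `dt_w` is a Haar measure. [cite: Folland1995, §2.2] -/
theorem isHaarMeasure_chartHaarHLoc : (chartHaarHLoc L S w).IsHaarMeasure := by
  haveI := locallyCompactSpace_chartTorusHLoc L S w
  unfold chartHaarHLoc
  infer_instance

/-- `dt_w` is regular. [cite: Folland1995, §2.2] -/
theorem regular_chartHaarHLoc : (chartHaarHLoc L S w).Regular := by
  haveI := locallyCompactSpace_chartTorusHLoc L S w
  haveI := secondCountableTopology_archLocal_two L w
  unfold chartHaarHLoc
  infer_instance

/-- `dt_w` is left invariant. [cite: Folland1995, §2.2] -/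
theorem isMulLeftInvariant_chartHaarHLoc : (chartHaarHLoc L S w).IsMulLeftInvariant :=
  haveI := isHaarMeasure_chartHaarHLoc L S w
  inferInstance

/-- `dt_w` is finite on compact sets. [cite: Folland1995, §2.2] -/
theorem isFiniteMeasureOnCompacts_chartHaarHLoc : IsFiniteMeasureOnCompacts (chartHaarHLoc L S w) :=
  haveI := isHaarMeasure_chartHaarHLoc L S w
  inferInstance

/-- `dt_w` is positive on open sets. [cite: Folland1995, §2.2] -/
theorem isOpenPosMeasure_chartHaarHLoc : (chartHaarHLoc L S w).IsOpenPosMeasure :=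
  haveI := isHaarMeasure_chartHaarHLoc L S w
  inferInstance

/-- `dt_w(B_{S,w}) < ∞` (compact). [cite: Folland1995, §2.2] -/
theorem chartHaarHLoc_chartBoxImgLoc_lt_top : chartHaarHLoc L S w (chartBoxImgLoc L S w) < ⊤ :=
  haveI := isHaarMeasure_chartHaarHLoc L S w
  (isCompact_chartBoxImgLoc L S w).measure_lt_top

/-- **`dt_w` is inversion invariant** (`T_{S,w}` is abelian; Mathlib `IsHaarMeasure.isInvInvariant_of_regular`) — the unimodularity binder of ★ `quotientMeasure`.
[cite: Folland1995, §2.2; §2.6 Thm. 2.49] -/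
theorem isInvInvariant_chartHaarHLoc : (chartHaarHLoc L S w).IsInvInvariant := by
  haveI := locallyCompactSpace_chartTorusHLoc L S w
  haveI := isHaarMeasure_chartHaarHLoc L S w
  haveI := regular_chartHaarHLoc L S w
  letI : CommGroup ↥(chartTorusHLoc L S w) := { (inferInstance : Group ↥(chartTorusHLoc L S w)) with mul_comm := chartTorusHLoc_mul_comm L S w }
  exact IsHaarMeasure.isInvInvariant_of_regular (chartHaarHLoc L S w)

/-- `dt_w` is σ-finite (regular Haar on a second countable group). [cite: Folland1995, §2.2] -/
theorem sigmaFinite_chartHaarHLoc : SigmaFinite (chartHaarHLoc L S w) := by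
  haveI := locallyCompactSpace_chartTorusHLoc L S w
  haveI := secondCountableTopology_archLocal_two L w
  haveI : SecondCountableTopology ↥(chartTorusHLoc L S w) := TopologicalSpace.Subtype.secondCountableTopology _
  haveI := isHaarMeasure_chartHaarHLoc L S w
  exact IsHaarMeasure.sigmaFinite _

variable (νw : Measure ↥(archLocal L 2 (Matrix.of fun i j : Fin 2 => if i.val + j.val + 1 = 2 then (1 : L) else 0) w)) [IsFiniteMeasureOnCompacts νw] [νw.IsMulRightInvariant]

/-- **THE LOCAL CHART QUOTIENT MEASURE `dν_w ∕ dt_w` on `U(Φ₂)_w ⧸ T_{S,w}`** (★ `quotientMeasure`, Deitmar–Echterhoff Thm. 1.5.3; the quotient carries its Borel σ-algebra).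
[cite: DeitmarEchterhoff2014, Thm. 1.5.3] [cite: Folland1995, §2.6 Thm. 2.49] -/
def chartQuotientMeasureHLoc :
    @Measure (↥(archLocal L 2 (Matrix.of fun i j : Fin 2 => if i.val + j.val + 1 = 2 then (1 : L) else 0) w) ⧸ chartTorusHLoc L S w) (borel _) := by
  letI : MeasurableSpace (↥(archLocal L 2 (Matrix.of fun i j : Fin 2 => if i.val + j.val + 1 = 2 then (1 : L) else 0) w) ⧸ chartTorusHLoc L S w) := borel _
  haveI : BorelSpace (↥(archLocal L 2 (Matrix.of fun i j : Fin 2 => if i.val + j.val + 1 = 2 then (1 : L) else 0) w) ⧸ chartTorusHLoc L S w) := ⟨rfl⟩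
  haveI := locallyCompactSpace_archLocal_two L w
  haveI := secondCountableTopology_archLocal_two L w
  haveI := isMulLeftInvariant_chartHaarHLoc L S w
  haveI := isFiniteMeasureOnCompacts_chartHaarHLoc L S w
  haveI := isOpenPosMeasure_chartHaarHLoc L S w
  haveI := isInvInvariant_chartHaarHLoc L S w
  exact quotientMeasure (chartTorusHLoc L S w) (chartHaarHLoc L S w) (isClosed_chartTorusHLoc L S w) νw

/-- **THE LOCAL CHART ORBITAL FUNCTIONAL** `chartOrbHLoc L ν_w S w f cw := dt_w(B_{S,w}) · ∫_{U(Φ₂)_w ⧸ T_{S,w}} f (x · endoBlockAt S w cw · x⁻¹) d(dν_w ∕ dt_w)(x̄)` (★ `descConj`),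
defined at EVERY local coordinate `cw`.  The prefactor `dt_w(B_{S,w})` makes it INDEPENDENT of the auxiliary Haar measure `dt_w` (PACK-SPEC (δ3), one place at a time);
the `w`-factor of ★ `chartOrbH` on product test functions and product Haar measures (sibling `ArchEndoscopicChartOrbPlaces`).
[cite: Rogawski1990, §8.2 p. 122; §8.3 p. 124] [cite: Shelstad1979, §4 p. 22] [cite: DeitmarEchterhoff2014, Thm. 1.5.3] -/
def chartOrbHLoc (f : ↥(archLocal L 2 (Matrix.of fun i j : Fin 2 => if i.val + j.val + 1 = 2 then (1 : L) else 0) w) → ℂ) (cw : Fin 3 → ℝ) : ℂ := by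
  letI : MeasurableSpace (↥(archLocal L 2 (Matrix.of fun i j : Fin 2 => if i.val + j.val + 1 = 2 then (1 : L) else 0) w) ⧸ chartTorusHLoc L S w) := borel _
  exact ((chartHaarHLoc L S w (chartBoxImgLoc L S w)).toReal : ℂ) *
    ∫ x, descConj (endoBlockAt L S w cw) (chartTorusHLoc L S w) (forall_mem_chartTorusHLoc_comm L S w cw) f x ∂(chartQuotientMeasureHLoc L S w νw)

/-- `chartOrbHLoc` unfolded (definitional). [cite: Rogawski1990, §8.2 p. 122] -/
theorem chartOrbHLoc_def (f : ↥(archLocal L 2 (Matrix.of fun i j : Fin 2 => if i.val + j.val + 1 = 2 then (1 : L) else 0) w) → ℂ) (cw : Fin 3 → ℝ) :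
    chartOrbHLoc L S w νw f cw =
      (letI : MeasurableSpace (↥(archLocal L 2 (Matrix.of fun i j : Fin 2 => if i.val + j.val + 1 = 2 then (1 : L) else 0) w) ⧸ chartTorusHLoc L S w) := borel _
       ((chartHaarHLoc L S w (chartBoxImgLoc L S w)).toReal : ℂ) *
         ∫ x, descConj (endoBlockAt L S w cw) (chartTorusHLoc L S w) (forall_mem_chartTorusHLoc_comm L S w cw) f x ∂(chartQuotientMeasureHLoc L S w νw)) := rfl

/-- **`chartOrbHLoc` depends on `cw` only through the local chart point `endoBlockAt S w cw`.** [cite: Rogawski1990, §8.2 p. 122] -/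
theorem chartOrbHLoc_congr (f : ↥(archLocal L 2 (Matrix.of fun i j : Fin 2 => if i.val + j.val + 1 = 2 then (1 : L) else 0) w) → ℂ)
    {cw cw' : Fin 3 → ℝ} (h : endoBlockAt L S w cw = endoBlockAt L S w cw') :
    chartOrbHLoc L S w νw f cw = chartOrbHLoc L S w νw f cw' := by
  rw [chartOrbHLoc_def, chartOrbHLoc_def]
  have hint : descConj (endoBlockAt L S w cw) (chartTorusHLoc L S w) (forall_mem_chartTorusHLoc_comm L S w cw) f =
      descConj (endoBlockAt L S w cw') (chartTorusHLoc L S w) (forall_mem_chartTorusHLoc_comm L S w cw') f := by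
    funext y
    induction y using QuotientGroup.induction_on with
    | H g => rw [descConj_mk, descConj_mk, h]
  rw [hint]

/-- In particular `chartOrbHLoc` reads only the slots `0` and `2` of `cw`. [cite: Rogawski1990, §8.2 p. 122] -/
theorem chartOrbHLoc_congr_slots (f : ↥(archLocal L 2 (Matrix.of fun i j : Fin 2 => if i.val + j.val + 1 = 2 then (1 : L) else 0) w) → ℂ)
    {cw cw' : Fin 3 → ℝ} (h0 : cw 0 = cw' 0) (h2 : cw 2 = cw' 2) :
    chartOrbHLoc L S w νw f cw = chartOrbHLoc L S w νw f cw' :=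
  chartOrbHLoc_congr L S w νw f (endoBlockAt_congr L S w h0 h2)

/-- `chartOrbHLoc ν_w S w 0 cw = 0`. [cite: Rogawski1990, §8.2 p. 122] -/
theorem chartOrbHLoc_zero (cw : Fin 3 → ℝ) : chartOrbHLoc L S w νw 0 cw = 0 := by
  rw [chartOrbHLoc_def]
  have h : descConj (endoBlockAt L S w cw) (chartTorusHLoc L S w) (forall_mem_chartTorusHLoc_comm L S w cw)
      (0 : ↥(archLocal L 2 (Matrix.of fun i j : Fin 2 => if i.val + j.val + 1 = 2 then (1 : L) else 0) w) → ℂ) = 0 := by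
    funext y
    induction y using QuotientGroup.induction_on
    rfl
  rw [h]
  simp only [Pi.zero_apply, integral_zero, mul_zero]

end LocalOrb

section Free

variable (L : Type) [Field L] (S : Finset {w : InfinitePlace L // IsComplex w}) (w : {w : InfinitePlace L // IsComplex w})
  [MeasurableSpace ↥(archLocal L 2 (Matrix.of fun i j : Fin 2 => if i.val + j.val + 1 = 2 then (1 : L) else 0) w)]
  [BorelSpace ↥(archLocal L 2 (Matrix.of fun i j : Fin 2 => if i.val + j.val + 1 = 2 then (1 : L) else 0) w)]
  (νw : Measure ↥(archLocal L 2 (Matrix.of fun i j : Fin 2 => if i.val + j.val + 1 = 2 then (1 : L) else 0) w)) [νw.IsHaarMeasure] [νw.IsMulRightInvariant]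

/-- **HAAR-FREENESS OF THE LOCAL CHART ORBITAL FUNCTIONAL**: for ANY inversion-invariant Haar measure `t` on `T_{S,w}` and a Haar measure `ν_w` on `U(Φ₂)_w`,
`chartOrbHLoc ν_w S w f cw = t(B_{S,w}) · ∫ f (x · endoBlockAt S w cw · x⁻¹) d(ν_w ∕ t)(x̄)` — the auxiliary `chartHaarHLoc` has disappeared (`t = κ • dt_w` by uniqueness,
`ν_w ∕ t = κ⁻¹ • (ν_w ∕ dt_w)` by ★ `quotientMeasure_eq_inv_smul_of_eq_smul`). [cite: Folland1995, §2.2; §2.6 Thm. 2.49] [cite: DeitmarEchterhoff2014, Thm. 1.5.3]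
[cite: Rogawski1990, §8.2 p. 122] -/
theorem chartOrbHLoc_eq_of_isHaarMeasure (t : Measure ↥(chartTorusHLoc L S w)) [t.IsHaarMeasure] [t.IsInvInvariant]
    (f : ↥(archLocal L 2 (Matrix.of fun i j : Fin 2 => if i.val + j.val + 1 = 2 then (1 : L) else 0) w) → ℂ) (cw : Fin 3 → ℝ) :
    chartOrbHLoc L S w νw f cw =
      (letI : MeasurableSpace (↥(archLocal L 2 (Matrix.of fun i j : Fin 2 => if i.val + j.val + 1 = 2 then (1 : L) else 0) w) ⧸ chartTorusHLoc L S w) := borel _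
       haveI : BorelSpace (↥(archLocal L 2 (Matrix.of fun i j : Fin 2 => if i.val + j.val + 1 = 2 then (1 : L) else 0) w) ⧸ chartTorusHLoc L S w) := ⟨rfl⟩
       haveI := locallyCompactSpace_archLocal_two L w
       haveI := secondCountableTopology_archLocal_two L w
       ((t (chartBoxImgLoc L S w)).toReal : ℂ) *
         ∫ x, descConj (endoBlockAt L S w cw) (chartTorusHLoc L S w) (forall_mem_chartTorusHLoc_comm L S w cw) f x
           ∂(quotientMeasure (chartTorusHLoc L S w) t (isClosed_chartTorusHLoc L S w) νw)) := by
  letI : MeasurableSpace (↥(archLocal L 2 (Matrix.of fun i j : Fin 2 => if i.val + j.val + 1 = 2 then (1 : L) else 0) w) ⧸ chartTorusHLoc L S w) := borel _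
  haveI : BorelSpace (↥(archLocal L 2 (Matrix.of fun i j : Fin 2 => if i.val + j.val + 1 = 2 then (1 : L) else 0) w) ⧸ chartTorusHLoc L S w) := ⟨rfl⟩
  haveI := locallyCompactSpace_archLocal_two L w
  haveI := secondCountableTopology_archLocal_two L w
  haveI := locallyCompactSpace_chartTorusHLoc L S w
  haveI := isHaarMeasure_chartHaarHLoc L S w
  haveI := isInvInvariant_chartHaarHLoc L S w
  set κ : ℝ≥0 := haarScalarFactor t (chartHaarHLoc L S w) with hκdef
  have hκ : κ ≠ 0 := (haarScalarFactor_pos_of_isHaarMeasure t (chartHaarHLoc L S w)).ne'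
  have ht : t = κ • chartHaarHLoc L S w := isMulLeftInvariant_eq_smul t (chartHaarHLoc L S w)
  have hQ := quotientMeasure_eq_inv_smul_of_eq_smul (chartTorusHLoc L S w) (isClosed_chartTorusHLoc L S w) (chartHaarHLoc L S w) t νw hκ ht
  rw [chartOrbHLoc_def]
  show ((chartHaarHLoc L S w (chartBoxImgLoc L S w)).toReal : ℂ) *
      ∫ x, descConj (endoBlockAt L S w cw) (chartTorusHLoc L S w) (forall_mem_chartTorusHLoc_comm L S w cw) f x
        ∂(quotientMeasure (chartTorusHLoc L S w) (chartHaarHLoc L S w) (isClosed_chartTorusHLoc L S w) νw) = _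
  rw [hQ, integral_smul_nnreal_measure, ht, Measure.smul_apply, ENNReal.smul_def, smul_eq_mul, ENNReal.toReal_mul, ENNReal.coe_toReal,
    NNReal.smul_def, Complex.real_smul, NNReal.coe_inv, Complex.ofReal_mul, Complex.ofReal_inv]
  have hκC : ((κ : ℝ) : ℂ) ≠ 0 := by exact_mod_cast hκ
  field_simp

/-- **`0 < dt_w(B_{S,w})`**: the prefactor of `chartOrbHLoc` is a genuine positive real. [cite: Folland1995, §2.2] -/
theorem chartHaarHLoc_chartBoxImgLoc_pos [NumberField L] [IsCMField L] : 0 < chartHaarHLoc L S w (chartBoxImgLoc L S w) :=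
  haveI := isOpenPosMeasure_chartHaarHLoc L S w
  measure_chartBoxImgLoc_pos L S w _

/-- The prefactor as a real number is positive. [cite: Folland1995, §2.2] -/
theorem toReal_chartHaarHLoc_chartBoxImgLoc_pos [NumberField L] [IsCMField L] : 0 < (chartHaarHLoc L S w (chartBoxImgLoc L S w)).toReal :=
  ENNReal.toReal_pos (chartHaarHLoc_chartBoxImgLoc_pos L S w).ne' (chartHaarHLoc_chartBoxImgLoc_lt_top L S w).ne

end Free

end Literature.NumberTheory.Automorphic.UnitaryGroup

end
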